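import Summits.QuantumFields.YangMills.Theorems.LuscherReductionRunningReductionTraceFormulaDefs

/-!
# Route `FemtoCutoffLadder` — DEFINITIONS posited by the `trace` lines of the step cruxes `OctaveStepDecay` (stmt-QuantumFields-24153) and
# `SubOctaveBounded` (stmt-QuantumFields-24085) (planner ym-idea-1 g2, registered skeletons `Cruxes.OctaveStepDecay.Trace`, `Cruxes.SubOctaveBounded.Trace`)

Filed by the lead seat `ym-line-fcl-p1` (2026-08-28) so that the registered stubs can be landed BY NAME (`theorem stub_excitedRatioUpper :
ExcitedRatioUpper`, …) from Theorems files without re-declaring skeleton-local `def`s inside proof files.  Verbatim bodies of the skeletons'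
`excitedRatio`, `slack`, `ExcitedRatioUpper`, `TowerTraceComparison`, `SubOctaveTraceComparison`; route-independent (no `Theses` import).
The two comparison Props are the HARD stubs (two-cutoff comparison of zero-flux partition functions along one dyadic tower / for one
incommensurable pair — behind `UVStabilityNonUniqueness`); `ExcitedRatioUpper` is proved in `FemtoTransferGapExcitedTrace.lean`
(`physTrace_excited_upper`).  R2b1 is a RECORD rung; no summit is proved by these lines; not the Clay gap.
-/

set_option autoImplicit false

noncomputable section

namespace Summit.QuantumFields.YangMills.Theorems.FemtoCutoffLadder.Trace

open Summit.QuantumFields.YangMills.Theorems.FemtoTransferGap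

/-- The EXCITED TRACE RATIO `E(L,β,T) = Z_phys(L,β,T)/λ₀(β,L)^T − 1` (`= Σ_{k≥1} (λ_k/λ₀)^T` by the trace formula).
[cite: MontvayMunster1994, (3.145)] -/
def excitedRatio (L : ℕ) [NeZero L] (β : ℝ) (T : ℕ) : ℝ :=
  TT.physTrace L β T / topValue su2Rep L β ^ T - 1

/-- The one-step slack of the step cruxes: `s = CΛ²/L'^σ + D(1/β' − 1/β)` (summable artefact rate plus the telescoping asymptotic-scaling
allowance R1). [cite: AllesFeoPanagopoulos1997, eq. (3.7)] -/
def slack (C σ D : ℝ) (β β' : ℝ) (L L' : ℕ) : ℝ :=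
  C * luscherLambda β L ^ 2 / (L' : ℝ) ^ σ + D * (1 / β' - 1 / β)

/-- Registered stub Prop (both trace skeletons; NOT a literature fact): first-term domination of the excited trace ratio,
`E(T) ≤ (λ₁/λ₀)^{T−2}·E(2)` for `T ≥ 2` on the window (PROVED: `physTrace_excited_upper`). -/
def ExcitedRatioUpper : Prop :=
  ∀ (lam : ℝ) (L : ℕ) [NeZero L] (β : ℝ) (T : ℕ), InFemtoWindow lam β L → 2 ≤ T →
    excitedRatio L β T ≤ (secondValue su2Rep L β / topValue su2Rep L β) ^ (T - 2) * excitedRatio L β 2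

/-- Registered HARD stub Prop of line `trace` on crux `OctaveStepDecay` (stmt-QuantumFields-24153; an OPEN crux-level claim of the route,
NOT a literature fact): TOWER TRACE COMPARISON — along one dyadic tower `L' = L₀·2^i`, `L = 2L'`, at matched label, the fine excited trace
ratio after `2T` steps is bounded by the coarse one after `T` steps up to `M·e^{s·T/L'}`. -/
def TowerTraceComparison : Prop :=
  ∃ (C σ D lam0 : ℝ) (L0 : ℕ), 0 < L0 ∧ 0 < σ ∧ 0 < lam0 ∧ 0 ≤ D ∧ ∀ lam : ℝ, 0 < lam → lam ≤ lam0 →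
    ∀ (i : ℕ) (L' : ℕ) [NeZero L'] (L : ℕ) [NeZero L], L' = L0 * 2 ^ i → L = 2 * L' → ∀ β β' : ℝ,
      InFemtoWindow lam β L → InFemtoWindow lam β' L' → luscherLambda β L = luscherLambda β' L' →
        ∃ (M : ℝ) (T0 : ℕ), ∀ T : ℕ, T0 ≤ T →
          excitedRatio L β (2 * T) ≤ M * Real.exp (slack C σ D β β' L L' * T / L') * excitedRatio L' β' T

/-- Registered HARD stub Prop of line `trace` on crux `SubOctaveBounded` (stmt-QuantumFields-24085; an OPEN crux-level claim of the route,
NOT a literature fact): SUB-OCTAVE TRACE COMPARISON — for one incommensurable pair `L' ≤ L < 2L'` at matched label, the excited trace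
ratios at equal physical time (`L·t` fine steps vs `L'·t` coarse steps) compare up to `M·e^{CΛ²·t}`. -/
def SubOctaveTraceComparison : Prop :=
  ∃ (C lam0 : ℝ) (L0 : ℕ), 0 < lam0 ∧ ∀ lam : ℝ, 0 < lam → lam ≤ lam0 →
    ∀ (L' : ℕ) [NeZero L'] (L : ℕ) [NeZero L], L0 ≤ L' → L' ≤ L → L < 2 * L' → ∀ β β' : ℝ,
      InFemtoWindow lam β L → InFemtoWindow lam β' L' → luscherLambda β L = luscherLambda β' L' →
        ∃ (M : ℝ) (t0 : ℕ), ∀ t : ℕ, t0 ≤ t →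
          excitedRatio L β (L * t) ≤ M * Real.exp (C * luscherLambda β L ^ 2 * t) * excitedRatio L' β' (L' * t)

end Summit.QuantumFields.YangMills.Theorems.FemtoCutoffLadder.Trace

end
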